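import Literature.Analysis.FluidPDE.TaoCascadeBlowupDynamicsWith
import Literature.Analysis.FluidPDE.TaoCascadeReducedClaimProofs
import Literature.Analysis.FluidPDE.TaoCascadeRescaledStepOrder
import HarnessLib

/-!
# Tao's cascade ODE: the corrected blowup-dynamics step (Prop. 6.4 with `ε⁻¹10⁻⁵e^{-K¹⁰/2}`) holds

T. Tao, *Finite time blowup for an averaged three-dimensional Navier–Stokes equation*,
J. Amer. Math. Soc. **29** (2016), 601–674 = arXiv:1402.0290v3, §6.3 Prop. 6.4, §6.4 Prop. 6.5,
§§6.5–6.7.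

`blowupDynamicsStepCorrected` (`TaoCascadeBlowupDynamicsWith.lean`) is the one-step statement of
Prop. 6.4 with the `c_n`-coefficient of (6.44) read as `ε⁻¹ · 10⁻⁵ e^{-K¹⁰/2}` (the value that the
initial data (6.34) and the rescaled hypothesis (6.62) actually carry; the printed `ε⁻¹e^{-K¹⁰}`
is a typo, see the docstring of `blowupDynamicsWith`). This file discharges it:

* `rescaledStepCorrected'_holds` (`TaoCascadeReducedClaimProofs.lean`) is the corrected rescaled
  step, Prop. 6.5, assembled from the bootstrap of §§6.5–6.7 (Prop. 6.13 in the regime,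
  `smallScaleOneInput_holds`; Prop. 6.15 in the `ZeroScale.Setting` packaging: the critical phase
  and `t_c` (`TaoCascadeZeroScaleCritical.lean`), `τ₁` and the rotor phase
  (`TaoCascadeZeroScaleTauOne.lean`), Props. 6.16–6.17 (`TaoCascadeZeroScaleCoarseBound.lean`),
  the fence (6.187)–(6.188) (`TaoCascadeZeroScaleFence.lean`), the drain (6.185)
  (`TaoCascadeZeroScaleDrainFinal.lean`) and the state bounds (6.139)–(6.144)
  (`TaoCascadeZeroScaleNextState.lean`));
* `blowupDynamicsStepWith_of_rescaledStepWith'` (`TaoCascadeRescaledStepOrder.lean`) is the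
  rescaling (6.53)–(6.54) of §6.4 turning Prop. 6.5 into Prop. 6.4.

(Theorem 6.2 `noGlobalODESolution` and the trajectory forms are discharged in
`TaoCascadeBlowupDynamicsHolds.lean`; the equivalences are in `TaoCascadeCorrectedEquiv.lean`.)
One theorem only.

## References

* T. Tao, J. Amer. Math. Soc. 29 (2016), 601–674 = arXiv:1402.0290v3, §6.3 Prop. 6.4, Thm. 6.2,
  §6.4 Prop. 6.5. [`Tao2016AveragedNS`]
-/

noncomputable section

namespace Literature.Analysis.FluidPDE

namespace TaoCascade

/-- **Prop. 6.4 (blowup dynamics, one step), corrected coefficient, holds.**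
[cite: Tao2016AveragedNS, §6.3 Prop. 6.4; §6.4 Prop. 6.5; §§6.5–6.7] -/
theorem blowupDynamicsStepCorrected_holds : blowupDynamicsStepCorrected :=
  blowupDynamicsStepWith_of_rescaledStepWith' rescaledStepCorrected'_holds

end TaoCascade

end Literature.Analysis.FluidPDE
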